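import Summits.CriticalPhenomena.PercolationContinuityZ3.Theorems.PercNearOneGluingNoHeavyLowerTailIncStarRSideCases
import HarnessLib

/-!
# The R-side lemma of THEOREM C½, II: the two-branch case (bridge step)

Support file for the Sahi programme (`--supports stmt-CriticalPhenomena-4575`, prover prim-sahi-p2 gen 19).  No definitions, no named
facts, no sorries; standard axioms.  Memo `FROM-prim-nh-lead-4575-g120-STAR-HALF.md` §5(iii) (lead g120), `prim-sahi-p2/PROOF-E3.md` (29h).
`RS(w; v; b, c)` as in `…IncStarRSideCases`; here `b` (with `x₁`) lies in the near side `L ∌ s` of the environment bridge `e₁ = s(x₁, v)` and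
`c ∉ L` (the lead's 'b, c in different branches at v'; `c` may lie outside `v`'s tree).  Conditioning on `e₁` with the machinery of
`…IncStarBridgeEvents` gives `RS = ½σ′T₁ + ((3/2)σ′ − 1)T₂`, `T₁ = pD₁b·g_c + d_c(pH₁b + (1−p)m_b)`, `T₂ = pD₁b·cov_c + d_c·Cov^B`
(`IncStar.rs_diffBranch_real`, by `ring`; the lead's `W[½σ′(D_bH_c + D_cH_b) + ((3/2)σ′ − 1)(D_bCov_c + D_cCov_b)]`), so `RS ≥ 0` from Harris
at `x₁` and at `v` (`T₂ ≤ 0`) and the branch lemmas at `(w[e₁↦0]; x₁, b)` and `(w[e₁↦0]; v, c)` (`T₁ + T₂ ≥ 0`; hypotheses here, =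
`IncStar.branchLemma`).  Exact brute force of `RS ≥ 0` under rule (R): gen19 `rs_check.py`, 0/500.
-/


noncomputable section

namespace Summit.CriticalPhenomena.PercolationContinuityZ3.Theorems

namespace IncStar

open MeasureTheory Set Literature.Probability.Percolation Literature.Probability.LatticeModels EdgeInduction
open scoped Classical

variable {n : ℕ}

/-- **R-side lemma, two-branch case (bridge step).** [this work] -/
theorem rs_bridge_step_diffBranch (w : Sym2 (Fin n) → unitInterval) (L : Set (Fin n)) {s x₁ v b c : Fin n}
    (hsL : s ∉ L) (hxL : x₁ ∈ L) (hvL : v ∉ L) (hbL : b ∈ L) (hcL : c ∉ L)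
    (hcross : ∀ x y : Fin n, x ∈ L → y ∉ L → y ≠ s → s(x, y) ≠ s(x₁, v) → w s(x, y) = 0)
    (BrNear : (prodBernoulli (Function.update w s(x₁, v) 0)).real (openConn s x₁)ᶜ * (prodBernoulli (Function.update w s(x₁, v) 0)).real (openConn b x₁ ∪ openConn s b)
        ≤ (prodBernoulli (Function.update w s(x₁, v) 0)).real (openConn b x₁ \ openConn s x₁) + 2 * (prodBernoulli (Function.update w s(x₁, v) 0)).real ((openConn s x₁)ᶜ ∩ (openConn b x₁)ᶜ ∩ openConn s b))
    (BrFar : (prodBernoulli (Function.update w s(x₁, v) 0)).real (openConn s v)ᶜ * (prodBernoulli (Function.update w s(x₁, v) 0)).real (openConn c v ∪ openConn s c)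
        ≤ (prodBernoulli (Function.update w s(x₁, v) 0)).real (openConn c v \ openConn s v) + 2 * (prodBernoulli (Function.update w s(x₁, v) 0)).real ((openConn s v)ᶜ ∩ (openConn c v)ᶜ ∩ openConn s c)) :
    0 ≤ (prodBernoulli w).real (openConn s v) * ((prodBernoulli w).real ((openConn b v \ openConn s v) ∩ openConn s c)
            + (prodBernoulli w).real ((openConn c v \ openConn s v) ∩ openConn s b) + (prodBernoulli w).real ((openConn b v ∩ openConn c v) \ openConn s v))
        + (prodBernoulli w).real (openConn b v \ openConn s v) * (prodBernoulli w).real (openConn s v ∩ openConn s c) + (prodBernoulli w).real (openConn c v \ openConn s v) * (prodBernoulli w).real (openConn s v ∩ openConn s b)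
        - 3 / 2 * (prodBernoulli w).real (openConn s v) * ((prodBernoulli w).real (openConn s b) * (prodBernoulli w).real (openConn c v \ openConn s v)
            + (prodBernoulli w).real (openConn s c) * (prodBernoulli w).real (openConn b v \ openConn s v))
        - 3 * (prodBernoulli w).real (openConn s v) * (prodBernoulli w).real (openConn b v \ openConn s v) * (prodBernoulli w).real (openConn c v \ openConn s v) := by
  -- names
  set e : Sym2 (Fin n) := s(x₁, v)
  set w0 := Function.update w e 0 with hw0
  set w1 := Function.update w e 1
  have hs1 : s ∈ insert s L := Set.mem_insert s L
  have hx1 : x₁ ∈ insert s L := Set.mem_insert_of_mem s hxL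
  have hb1 : b ∈ insert s L := Set.mem_insert_of_mem s hbL
  set S : Set (BondConfig (Fin n)) := openConnIn (insert s L) s x₁
  set Bn : Set (BondConfig (Fin n)) := openConnIn (insert s L) s b
  set Fb : Set (BondConfig (Fin n)) := openConnIn (insert s L) b x₁
  set W' : Set (BondConfig (Fin n)) := openConnIn Lᶜ s v
  set Cf : Set (BondConfig (Fin n)) := openConnIn Lᶜ s c
  set Rc : Set (BondConfig (Fin n)) := openConnIn Lᶜ c v
  -- (0) the bridge hypothesis under `w0`, the almost-sure set, independence
  have hw0cross : ∀ x y : Fin n, x ∈ L → y ∉ L → y ≠ s → w0 s(x, y) = 0 := by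
    intro x y hx hy hys
    by_cases hxy : s(x, y) = e
    · rw [hxy, hw0, Function.update_self]
    · rw [hw0, Function.update_of_ne hxy]; exact hcross x y hx hy hys hxy
  set G : Set (BondConfig (Fin n)) := {ω | ∀ e', w0 e' = 0 → e' ∉ ω}
  have hG1 : (prodBernoulli w0).real G = 1 := real_sureClosed w0
  have hωG : ∀ ω ∈ G, ∀ x y : Fin n, x ∈ L → y ∉ L → y ≠ s → s(x, y) ∉ ω :=
    fun ω hω x y hx hy hys => hω _ (hw0cross x y hx hy hys)
  have hm : ∀ X : Set (BondConfig (Fin n)), MeasurableSet X := fun _ => MeasurableSet.of_discrete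
  have hdiff : ∀ {A B : Set (BondConfig (Fin n))} {K' : Set (Sym2 (Fin n))},
      DeterminedBy A K' → DeterminedBy B K' → DeterminedBy (A \ B) K' := by
    intro A B K' hA hB
    rw [determinedBy_iff] at hA hB ⊢
    intro ω ω' h
    rw [Set.mem_sdiff, Set.mem_sdiff, hA ω ω' h, hB ω ω' h]
  have hdn : ∀ x y : Fin n, DeterminedBy (openConnIn (insert s L) x y : Set (BondConfig (Fin n)))
      {z : Sym2 (Fin n) | ¬ z.IsDiag ∧ ∀ x ∈ z, x ∈ insert s L} := fun x y => IncStarCutVertex.determinedBy_openConnIn_offDiag _ x y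
  have hdf : ∀ x y : Fin n, DeterminedBy (openConnIn Lᶜ x y : Set (BondConfig (Fin n)))
      {z : Sym2 (Fin n) | ¬ z.IsDiag ∧ ∀ x ∈ z, x ∈ Lᶜ} := fun x y => IncStarCutVertex.determinedBy_openConnIn_offDiag _ x y
  have hdW'c : DeterminedBy (Set.univ \ W') {z : Sym2 (Fin n) | ¬ z.IsDiag ∧ ∀ x ∈ z, x ∈ Lᶜ} := hdiff (determinedBy_univ _) (hdf s v)
  have hdSc : DeterminedBy (Set.univ \ S) {z : Sym2 (Fin n) | ¬ z.IsDiag ∧ ∀ x ∈ z, x ∈ insert s L} := hdiff (determinedBy_univ _) (hdn s x₁)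
  have indep : ∀ {A B : Set (BondConfig (Fin n))}, DeterminedBy A {z : Sym2 (Fin n) | ¬ z.IsDiag ∧ ∀ x ∈ z, x ∈ insert s L} →
      DeterminedBy B {z : Sym2 (Fin n) | ¬ z.IsDiag ∧ ∀ x ∈ z, x ∈ Lᶜ} →
      (prodBernoulli w0).real (A ∩ B) = (prodBernoulli w0).real A * (prodBernoulli w0).real B :=
    fun hA hB => indep_blocks w0 L s hA hB
  have hBFS : ∀ ω, ω ∈ Bn → ω ∈ Fb → ω ∈ S := fun ω hB hF => PlanarDuality.openConnIn_trans hB hF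
  have hFSB : ∀ ω, ω ∈ Fb → ω ∈ S → ω ∈ Bn := fun ω hF hS => PlanarDuality.openConnIn_trans hS (openConnIn_symm' hF)
  have hCRW : ∀ ω, ω ∈ Cf → ω ∈ Rc → ω ∈ W' := fun ω hC hR => PlanarDuality.openConnIn_trans hC hR
  have hRWC : ∀ ω, ω ∈ Rc → ω ∈ W' → ω ∈ Cf := fun ω hR hW => PlanarDuality.openConnIn_trans hW (openConnIn_symm' hR)
  -- (1) dictionary on the sure set
  have c_sv : ∀ ω ∈ G, (ω ∈ openConn s v ↔ ω ∈ W') := fun ω hω => by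
    rw [bridge_conn_lr L hsL (hωG ω hω) hs1 hvL]
    exact ⟨fun h => h.2, fun h => ⟨⟨hs1, hs1, SimpleGraph.Reachable.refl _⟩, h⟩⟩
  have c_sb : ∀ ω ∈ G, (ω ∈ openConn s b ↔ ω ∈ Bn) := fun ω hω => bridge_conn_ll L hsL (hωG ω hω) hs1 hb1
  have c_sc : ∀ ω ∈ G, (ω ∈ openConn s c ↔ ω ∈ Cf) := fun ω hω => by
    rw [bridge_conn_lr L hsL (hωG ω hω) hs1 hcL]
    exact ⟨fun h => h.2, fun h => ⟨⟨hs1, hs1, SimpleGraph.Reachable.refl _⟩, h⟩⟩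
  have c_bv : ∀ ω ∈ G, (ω ∈ openConn b v ↔ ω ∈ Bn ∧ ω ∈ W') := fun ω hω => by
    rw [bridge_conn_lr L hsL (hωG ω hω) hb1 hvL]
    exact ⟨fun h => ⟨openConnIn_symm' h.1, h.2⟩, fun h => ⟨openConnIn_symm' h.1, h.2⟩⟩
  have c_cv : ∀ ω ∈ G, (ω ∈ openConn c v ↔ ω ∈ Rc) := fun ω hω => bridge_conn_rr L hsL (hωG ω hω) hcL hvL
  have c_bx : ∀ ω ∈ G, (ω ∈ openConn b x₁ ↔ ω ∈ Fb) := fun ω hω => bridge_conn_ll L hsL (hωG ω hω) hb1 hx1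
  have c_cx : ∀ ω ∈ G, (ω ∈ openConn c x₁ ↔ ω ∈ Cf ∧ ω ∈ S) := fun ω hω => by
    rw [bridge_conn_rl L hsL (hωG ω hω) hcL hx1]
    exact ⟨fun h => ⟨openConnIn_symm' h.1, h.2⟩, fun h => ⟨openConnIn_symm' h.1, h.2⟩⟩
  have c_sx : ∀ ω ∈ G, (ω ∈ openConn s x₁ ↔ ω ∈ S) := fun ω hω => bridge_conn_ll L hsL (hωG ω hω) hs1 hx1
  -- (2) lifted events
  have l_sv : ∀ ω ∈ G, (insert e ω ∈ openConn s v ↔ ω ∈ W' ∨ ω ∈ S) := fun ω hω => by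
    rw [bridge_lift_far L hsL hxL hvL hvL (hωG ω hω)]
    have hvv : ω ∈ openConnIn Lᶜ v v := ⟨hvL, hvL, SimpleGraph.Reachable.refl _⟩
    exact ⟨fun h => h.imp id fun h' => h'.1, fun h => h.imp id fun h' => ⟨h', hvv⟩⟩
  have l_sb : ∀ ω ∈ G, (insert e ω ∈ openConn s b ↔ ω ∈ Bn ∨ (ω ∈ W' ∧ ω ∈ Fb)) := fun ω hω => by
    rw [bridge_lift_near L hsL hxL hvL hbL (hωG ω hω)]
    exact ⟨fun h => h.imp id fun h' => ⟨h'.1, openConnIn_symm' h'.2⟩, fun h => h.imp id fun h' => ⟨h'.1, openConnIn_symm' h'.2⟩⟩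
  have l_sc : ∀ ω ∈ G, (insert e ω ∈ openConn s c ↔ ω ∈ Cf ∨ (ω ∈ S ∧ ω ∈ Rc)) := fun ω hω => by
    rw [bridge_lift_far L hsL hxL hvL hcL (hωG ω hω)]
    exact ⟨fun h => h.imp id fun h' => ⟨h'.1, openConnIn_symm' h'.2⟩, fun h => h.imp id fun h' => ⟨h'.1, openConnIn_symm' h'.2⟩⟩
  have l_bv : ∀ ω ∈ G, (insert e ω ∈ openConn b v ↔ (ω ∈ Bn ∧ ω ∈ W') ∨ ω ∈ Fb) := fun ω hω => by
    rw [insert_pair_mem_openConn_iff, c_bv ω hω, c_bx ω hω]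
    have hvv : ω ∈ openConn v v := SimpleGraph.Reachable.refl _
    constructor
    · rintro (h | ⟨h1, -⟩)
      · exact Or.inl h
      · exact h1.symm
    · rintro (h | h)
      · exact Or.inl h
      · exact Or.inr ⟨Or.inl h, Or.inr hvv⟩
  have l_cv : ∀ ω ∈ G, (insert e ω ∈ openConn c v ↔ ω ∈ Rc ∨ (ω ∈ Cf ∧ ω ∈ S)) := fun ω hω => by
    rw [insert_pair_mem_openConn_iff, c_cv ω hω, c_cx ω hω]
    have hvv : ω ∈ openConn v v := SimpleGraph.Reachable.refl _
    constructor
    · rintro (h | ⟨h1, -⟩)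
      · exact Or.inl h
      · exact h1.symm
    · rintro (h | h)
      · exact Or.inl h
      · exact Or.inr ⟨Or.inl h, Or.inr hvv⟩
  -- (3) one-bond decomposition and the lift
  have ob : ∀ A : Set (BondConfig (Fin n)),
      (prodBernoulli w).real A = (1 - (w e : ℝ)) * (prodBernoulli w0).real A + (w e : ℝ) * (prodBernoulli w1).real A := by
    intro A
    have hA : DeterminedBy A (↑(Finset.univ : Finset (Sym2 (Fin n))) : Set (Sym2 (Fin n))) := by
      rw [determinedBy_iff]
      intro ω ω' h
      rw [Finset.coe_univ, Set.inter_univ, Set.inter_univ] at h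
      rw [h]
    exact prodBernoulli_real_oneBond hA w (Finset.mem_univ e)
  have lift : ∀ A : Set (BondConfig (Fin n)),
      (prodBernoulli w1).real A = (prodBernoulli w0).real ((fun ω : BondConfig (Fin n) => insert e ω) ⁻¹' A) :=
    fun A => tieLiftOne_real_one_eq w e A
  have zero_of_empty : ∀ {A : Set (BondConfig (Fin n))}, (∀ ω ∈ G, ω ∉ A) → (prodBernoulli w0).real A = 0 := by
    intro A hA
    have h : (prodBernoulli w0).real A = (prodBernoulli w0).real (∅ : Set (BondConfig (Fin n))) :=
      real_congr_of_sure hG1 fun ω hω => ⟨fun h => (hA ω hω h).elim, fun h => (Set.notMem_empty _ h).elim⟩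
    rw [h, measureReal_empty]
  -- complements and splits
  have hσ : (prodBernoulli w).real (openConn s v) = 1 - (prodBernoulli w).real (openConn s v)ᶜ := by
    rw [probReal_compl_eq_one_sub (hm _)]; ring
  have hW'c : (prodBernoulli w0).real W' = 1 - (prodBernoulli w0).real (Set.univ \ W') := by
    rw [← Set.compl_eq_univ_sdiff, probReal_compl_eq_one_sub (hm _)]; ring
  have hSc : (prodBernoulli w0).real S = 1 - (prodBernoulli w0).real (Set.univ \ S) := by
    rw [← Set.compl_eq_univ_sdiff, probReal_compl_eq_one_sub (hm _)]; ring
  have hnb : (Bn \ S : Set (BondConfig (Fin n))) = (Bn \ S) \ Fb := by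
    ext ω; simp only [Set.mem_sdiff]
    exact ⟨fun h => ⟨h, fun hF => h.2 (hBFS ω h.1 hF)⟩, fun h => h.1⟩
  have hfb : (Fb \ Bn : Set (BondConfig (Fin n))) = Fb \ S := by
    ext ω; simp only [Set.mem_sdiff]
    exact ⟨fun h => ⟨h.1, fun hS => h.2 (hFSB ω h.1 hS)⟩, fun h => ⟨h.1, fun hB => h.2 (hBFS ω hB h.1)⟩⟩
  have hrc : (Rc \ Cf : Set (BondConfig (Fin n))) = Rc \ W' := by
    ext ω; simp only [Set.mem_sdiff]
    exact ⟨fun h => ⟨h.1, fun hW => h.2 (hRWC ω h.1 hW)⟩, fun h => ⟨h.1, fun hC => h.2 (hCRW ω hC h.1)⟩⟩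
  have hk : (prodBernoulli w0).real (Bn ∩ S) + (prodBernoulli w0).real ((Bn \ S) \ Fb) = (prodBernoulli w0).real Bn := by
    rw [← hnb]; exact measureReal_inter_add_sdiff (hm _)
  have hy : (prodBernoulli w0).real (Cf ∩ W') + (prodBernoulli w0).real (Cf \ W') = (prodBernoulli w0).real Cf :=
    measureReal_inter_add_sdiff (hm _)
  have hz : (prodBernoulli w0).real (Rc ∪ Cf) = (prodBernoulli w0).real Cf + (prodBernoulli w0).real (Rc \ W') := by
    rw [← hrc, Set.union_comm, ← measureReal_union Set.disjoint_sdiff_right (hm _), Set.union_sdiff_self]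
  -- (4) moments under `w0`
  have a0 : (prodBernoulli w0).real (openConn s v)ᶜ = (prodBernoulli w0).real (Set.univ \ W') :=
    real_congr_of_sure hG1 fun ω hω => by
      rw [Set.mem_compl_iff, c_sv ω hω, Set.mem_sdiff]; exact ⟨fun h => ⟨Set.mem_univ _, h⟩, fun h => h.2⟩
  have db0 : (prodBernoulli w0).real (openConn b v \ openConn s v) = 0 :=
    zero_of_empty fun ω hω h => by rw [Set.mem_sdiff, c_bv ω hω, c_sv ω hω] at h; exact h.2 h.1.2
  have dc0 : (prodBernoulli w0).real (openConn c v \ openConn s v) = (prodBernoulli w0).real (Rc \ W') :=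
    real_congr_of_sure hG1 fun ω hω => by rw [Set.mem_sdiff, Set.mem_sdiff, c_cv ω hω, c_sv ω hω]
  have dbc0 : (prodBernoulli w0).real ((openConn b v ∩ openConn c v) \ openConn s v) = 0 :=
    zero_of_empty fun ω hω h => by
      rw [Set.mem_sdiff, Set.mem_inter_iff, c_bv ω hω, c_sv ω hω] at h; exact h.2 h.1.1.2
  have xb0 : (prodBernoulli w0).real ((openConn b v \ openConn s v) ∩ openConn s c) = 0 :=
    zero_of_empty fun ω hω h => by
      rw [Set.mem_inter_iff, Set.mem_sdiff, c_bv ω hω, c_sv ω hω] at h; exact h.1.2 h.1.1.2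
  have xc0 : (prodBernoulli w0).real ((openConn c v \ openConn s v) ∩ openConn s b)
      = (prodBernoulli w0).real Bn * (prodBernoulli w0).real (Rc \ W') := by
    rw [← indep (hdn s b) (hdiff (hdf c v) (hdf s v))]
    refine real_congr_of_sure hG1 fun ω hω => ?_
    simp only [Set.mem_inter_iff, Set.mem_sdiff, c_cv ω hω, c_sv ω hω, c_sb ω hω]
    tauto
  have hc0 : (prodBernoulli w0).real ((openConn s v)ᶜ ∩ (openConn c v)ᶜ ∩ openConn s c) = (prodBernoulli w0).real (Cf \ W') :=
    real_congr_of_sure hG1 fun ω hω => by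
      simp only [Set.mem_inter_iff, Set.mem_compl_iff, Set.mem_sdiff, c_sv ω hω, c_cv ω hω, c_sc ω hω]
      exact ⟨fun h => ⟨h.2, h.1.1⟩, fun h => ⟨⟨h.2, fun hR => h.2 (hCRW ω h.1 hR)⟩, h.1⟩⟩
  have zc0 : (prodBernoulli w0).real (openConn c v ∪ openConn s c) = (prodBernoulli w0).real (Rc ∪ Cf) :=
    real_congr_of_sure hG1 fun ω hω => by rw [Set.mem_union, Set.mem_union, c_cv ω hω, c_sc ω hω]
  have yb0 : (prodBernoulli w0).real (openConn s v ∩ openConn s b) = (prodBernoulli w0).real Bn * (prodBernoulli w0).real W' := by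
    rw [← indep (hdn s b) (hdf s v)]
    exact real_congr_of_sure hG1 fun ω hω => by rw [Set.mem_inter_iff, Set.mem_inter_iff, c_sv ω hω, c_sb ω hω]; tauto
  have yc0 : (prodBernoulli w0).real (openConn s v ∩ openConn s c) = (prodBernoulli w0).real (Cf ∩ W') :=
    real_congr_of_sure hG1 fun ω hω => by rw [Set.mem_inter_iff, Set.mem_inter_iff, c_sv ω hω, c_sc ω hω]; tauto
  have mb0 : (prodBernoulli w0).real (openConn s b) = (prodBernoulli w0).real Bn := real_congr_of_sure hG1 c_sb
  have mc0 : (prodBernoulli w0).real (openConn s c) = (prodBernoulli w0).real Cf := real_congr_of_sure hG1 c_sc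
  -- (5) moments under `w1`
  have a1 : (prodBernoulli w1).real (openConn s v)ᶜ
      = (prodBernoulli w0).real (Set.univ \ S) * (prodBernoulli w0).real (Set.univ \ W') := by
    rw [lift, ← indep hdSc hdW'c]
    refine real_congr_of_sure hG1 fun ω hω => ?_
    simp only [Set.preimage_compl, Set.mem_compl_iff, Set.mem_preimage, l_sv ω hω, Set.mem_inter_iff, Set.mem_sdiff, Set.mem_univ, true_and]
    tauto
  have db1 : (prodBernoulli w1).real (openConn b v \ openConn s v)
      = (prodBernoulli w0).real (Fb \ S) * (prodBernoulli w0).real (Set.univ \ W') := by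
    rw [lift, ← indep (hdiff (hdn b x₁) (hdn s x₁)) hdW'c]
    refine real_congr_of_sure hG1 fun ω hω => ?_
    simp only [Set.preimage_sdiff, Set.mem_sdiff, Set.mem_preimage, l_bv ω hω, l_sv ω hω, Set.mem_inter_iff, Set.mem_univ, true_and]
    tauto
  have dc1 : (prodBernoulli w1).real (openConn c v \ openConn s v)
      = (prodBernoulli w0).real (Set.univ \ S) * (prodBernoulli w0).real (Rc \ W') := by
    rw [lift, ← indep hdSc (hdiff (hdf c v) (hdf s v))]
    refine real_congr_of_sure hG1 fun ω hω => ?_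
    simp only [Set.preimage_sdiff, Set.mem_sdiff, Set.mem_preimage, l_cv ω hω, l_sv ω hω, Set.mem_inter_iff, Set.mem_univ, true_and]
    tauto
  have dbc1 : (prodBernoulli w1).real ((openConn b v ∩ openConn c v) \ openConn s v)
      = (prodBernoulli w0).real (Fb \ S) * (prodBernoulli w0).real (Rc \ W') := by
    rw [lift, ← indep (hdiff (hdn b x₁) (hdn s x₁)) (hdiff (hdf c v) (hdf s v))]
    refine real_congr_of_sure hG1 fun ω hω => ?_
    simp only [Set.preimage_sdiff, Set.preimage_inter, Set.mem_sdiff, Set.mem_inter_iff, Set.mem_preimage, l_bv ω hω, l_cv ω hω, l_sv ω hω]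
    tauto
  have xb1 : (prodBernoulli w1).real ((openConn b v \ openConn s v) ∩ openConn s c)
      = (prodBernoulli w0).real (Fb \ S) * (prodBernoulli w0).real (Cf \ W') := by
    rw [lift, ← indep (hdiff (hdn b x₁) (hdn s x₁)) (hdiff (hdf s c) (hdf s v))]
    refine real_congr_of_sure hG1 fun ω hω => ?_
    simp only [Set.preimage_sdiff, Set.preimage_inter, Set.mem_sdiff, Set.mem_inter_iff, Set.mem_preimage, l_bv ω hω, l_sc ω hω, l_sv ω hω, not_or]
    constructor
    · rintro ⟨⟨hbv, hW, hS⟩, hc⟩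
      have hF : ω ∈ Fb := hbv.resolve_left fun h => hW h.2
      exact ⟨⟨hF, hS⟩, hc.resolve_right fun h => hS h.1, hW⟩
    · rintro ⟨⟨hF, hS⟩, hC, hW⟩
      exact ⟨⟨Or.inr hF, hW, hS⟩, Or.inl hC⟩
  have xc1 : (prodBernoulli w1).real ((openConn c v \ openConn s v) ∩ openConn s b)
      = (prodBernoulli w0).real ((Bn \ S) \ Fb) * (prodBernoulli w0).real (Rc \ W') := by
    rw [lift, ← indep (hdiff (hdiff (hdn s b) (hdn s x₁)) (hdn b x₁)) (hdiff (hdf c v) (hdf s v))]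
    refine real_congr_of_sure hG1 fun ω hω => ?_
    simp only [Set.preimage_sdiff, Set.preimage_inter, Set.mem_sdiff, Set.mem_inter_iff, Set.mem_preimage, l_cv ω hω, l_sb ω hω, l_sv ω hω, not_or]
    constructor
    · rintro ⟨⟨hcv, hW, hS⟩, hb⟩
      have hR : ω ∈ Rc := hcv.resolve_right fun h => hS h.2
      have hB : ω ∈ Bn := hb.resolve_right fun h => hW h.1
      exact ⟨⟨⟨hB, hS⟩, fun hF => hS (hBFS ω hB hF)⟩, hR, hW⟩
    · rintro ⟨⟨⟨hB, hS⟩, -⟩, hR, hW⟩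
      exact ⟨⟨Or.inl hR, hW, hS⟩, Or.inl hB⟩
  have yb1 : (prodBernoulli w1).real (openConn s v ∩ openConn s b)
      = (prodBernoulli w0).real Bn * (prodBernoulli w0).real W' + (prodBernoulli w0).real (Fb \ S) * (prodBernoulli w0).real W'
        + (prodBernoulli w0).real (Bn ∩ S) * (prodBernoulli w0).real (Set.univ \ W') := by
    rw [lift, ← indep (hdn s b) (hdf s v), ← indep (hdiff (hdn b x₁) (hdn s x₁)) (hdf s v), ← indep ((hdn s b).inter (hdn s x₁)) hdW'c,
      ← measureReal_union ?_ (hm _), ← measureReal_union ?_ (hm _)]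
    · refine real_congr_of_sure hG1 fun ω hω => ?_
      simp only [Set.preimage_inter, Set.mem_inter_iff, Set.mem_preimage, l_sv ω hω, l_sb ω hω, Set.mem_union, Set.mem_sdiff, Set.mem_univ, true_and]
      constructor
      · rintro ⟨hW | hS, hB | ⟨hW', hF⟩⟩
        · exact Or.inl (Or.inl ⟨hB, hW⟩)
        · by_cases hB : ω ∈ Bn
          · exact Or.inl (Or.inl ⟨hB, hW⟩)
          · exact Or.inl (Or.inr ⟨⟨hF, fun hS => hB (hFSB ω hF hS)⟩, hW'⟩)
        · by_cases hW : ω ∈ W'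
          · exact Or.inl (Or.inl ⟨hB, hW⟩)
          · exact Or.inr ⟨⟨hB, hS⟩, hW⟩
        · exact Or.inl (Or.inl ⟨hFSB ω hF hS, hW'⟩)
      · rintro ((⟨hB, hW⟩ | ⟨⟨hF, -⟩, hW⟩) | ⟨⟨hB, hS⟩, -⟩)
        · exact ⟨Or.inl hW, Or.inl hB⟩
        · exact ⟨Or.inl hW, Or.inr ⟨hW, hF⟩⟩
        · exact ⟨Or.inr hS, Or.inl hB⟩
    · exact Set.disjoint_left.2 fun ω h1 h2 => by
        rcases h1 with ⟨-, hW⟩ | ⟨-, hW⟩ <;> exact h2.2.2 hW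
    · exact Set.disjoint_left.2 fun ω h1 h2 => h2.1.2 (hBFS ω h1.1 h2.1.1)
  have yc1 : (prodBernoulli w1).real (openConn s v ∩ openConn s c)
      = (prodBernoulli w0).real (Cf ∩ W') + (prodBernoulli w0).real S * (prodBernoulli w0).real (Cf \ W')
        + (prodBernoulli w0).real S * (prodBernoulli w0).real (Rc \ W') := by
    rw [lift, ← indep (hdn s x₁) (hdiff (hdf s c) (hdf s v)), ← indep (hdn s x₁) (hdiff (hdf c v) (hdf s v)),
      ← measureReal_union ?_ (hm _), ← measureReal_union ?_ (hm _)]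
    · refine real_congr_of_sure hG1 fun ω hω => ?_
      simp only [Set.preimage_inter, Set.mem_inter_iff, Set.mem_preimage, l_sv ω hω, l_sc ω hω, Set.mem_union, Set.mem_sdiff]
      constructor
      · rintro ⟨hW | hS, hC | ⟨hS', hR⟩⟩
        · exact Or.inl (Or.inl ⟨hC, hW⟩)
        · exact Or.inl (Or.inl ⟨hRWC ω hR hW, hW⟩)
        · by_cases hW : ω ∈ W'
          · exact Or.inl (Or.inl ⟨hC, hW⟩)
          · exact Or.inl (Or.inr ⟨hS, hC, hW⟩)
        · by_cases hW : ω ∈ W'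
          · exact Or.inl (Or.inl ⟨hRWC ω hR hW, hW⟩)
          · exact Or.inr ⟨hS', hR, hW⟩
      · rintro ((⟨hC, hW⟩ | ⟨hS, hC, -⟩) | ⟨hS, hR, -⟩)
        · exact ⟨Or.inl hW, Or.inl hC⟩
        · exact ⟨Or.inr hS, Or.inl hC⟩
        · exact ⟨Or.inr hS, Or.inr ⟨hS, hR⟩⟩
    · exact Set.disjoint_left.2 fun ω h1 h2 => by
        rcases h1 with ⟨hC, hW⟩ | ⟨-, hC, hW⟩
        · exact h2.2.2 hW
        · exact h2.2.2 (hCRW ω hC h2.2.1)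
    · exact Set.disjoint_left.2 fun ω h1 h2 => h2.2.2 h1.2
  have mb1 : (prodBernoulli w1).real (openConn s b) = (prodBernoulli w0).real Bn + (prodBernoulli w0).real (Fb \ S) * (prodBernoulli w0).real W' := by
    rw [lift, ← indep (hdiff (hdn b x₁) (hdn s x₁)) (hdf s v), ← measureReal_union ?_ (hm _)]
    · refine real_congr_of_sure hG1 fun ω hω => ?_
      simp only [Set.mem_preimage, l_sb ω hω, Set.mem_union, Set.mem_inter_iff, Set.mem_sdiff]
      constructor
      · rintro (hB | ⟨hW, hF⟩)
        · exact Or.inl hB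
        · by_cases hB : ω ∈ Bn
          · exact Or.inl hB
          · exact Or.inr ⟨⟨hF, fun hS => hB (hFSB ω hF hS)⟩, hW⟩
      · rintro (hB | ⟨⟨hF, -⟩, hW⟩)
        · exact Or.inl hB
        · exact Or.inr ⟨hW, hF⟩
    · exact Set.disjoint_left.2 fun ω hB h2 => h2.1.2 (hBFS ω hB h2.1.1)
  have mc1 : (prodBernoulli w1).real (openConn s c) = (prodBernoulli w0).real Cf + (prodBernoulli w0).real S * (prodBernoulli w0).real (Rc \ W') := by
    rw [lift, ← indep (hdn s x₁) (hdiff (hdf c v) (hdf s v)), ← measureReal_union ?_ (hm _)]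
    · refine real_congr_of_sure hG1 fun ω hω => ?_
      simp only [Set.mem_preimage, l_sc ω hω, Set.mem_union, Set.mem_inter_iff, Set.mem_sdiff]
      constructor
      · rintro (hC | ⟨hS, hR⟩)
        · exact Or.inl hC
        · by_cases hW : ω ∈ W'
          · exact Or.inl (hRWC ω hR hW)
          · exact Or.inr ⟨hS, hR, hW⟩
      · rintro (hC | ⟨hS, hR, -⟩)
        · exact Or.inl hC
        · exact Or.inr ⟨hS, hR⟩
    · exact Set.disjoint_left.2 fun ω hC h2 => h2.2.2 (hCRW ω hC h2.2.1)
  -- the branch lemmas and Harris in block form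
  have eA₁ : (prodBernoulli w0).real (openConn s x₁)ᶜ = (prodBernoulli w0).real (Set.univ \ S) :=
    real_congr_of_sure hG1 fun ω hω => by
      rw [Set.mem_compl_iff, c_sx ω hω, Set.mem_sdiff]; exact ⟨fun h => ⟨Set.mem_univ _, h⟩, fun h => h.2⟩
  have eDb : (prodBernoulli w0).real (openConn b x₁ \ openConn s x₁) = (prodBernoulli w0).real (Fb \ S) :=
    real_congr_of_sure hG1 fun ω hω => by rw [Set.mem_sdiff, Set.mem_sdiff, c_bx ω hω, c_sx ω hω]
  have eHb : (prodBernoulli w0).real ((openConn s x₁)ᶜ ∩ (openConn b x₁)ᶜ ∩ openConn s b)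
      = (prodBernoulli w0).real ((Bn \ S) \ Fb) :=
    real_congr_of_sure hG1 fun ω hω => by
      simp only [Set.mem_inter_iff, Set.mem_compl_iff, c_sx ω hω, c_bx ω hω, c_sb ω hω, Set.mem_sdiff]; tauto
  have eZb : (prodBernoulli w0).real (openConn b x₁ ∪ openConn s b) = (prodBernoulli w0).real Bn + (prodBernoulli w0).real (Fb \ S) := by
    rw [← measureReal_union ?_ (hm _)]
    · refine real_congr_of_sure hG1 fun ω hω => ?_
      rw [Set.mem_union, Set.mem_union, c_bx ω hω, c_sb ω hω, Set.mem_sdiff]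
      constructor
      · rintro (hF | hB)
        · by_cases hB : ω ∈ Bn
          · exact Or.inl hB
          · exact Or.inr ⟨hF, fun hS => hB (hFSB ω hF hS)⟩
        · exact Or.inl hB
      · rintro (hB | ⟨hF, -⟩)
        · exact Or.inr hB
        · exact Or.inl hF
    · exact Set.disjoint_left.2 fun ω hB h2 => h2.2 (hBFS ω hB h2.1)
  have HarNear : (prodBernoulli w0).real (Fb \ S) + (prodBernoulli w0).real ((Bn \ S) \ Fb)
      ≤ (prodBernoulli w0).real (Set.univ \ S) * ((prodBernoulli w0).real Bn + (prodBernoulli w0).real (Fb \ S)) := by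
    have h := prodBernoulli_harris_upper_lower w0 ((isUpperSet_openConn b x₁).union (isUpperSet_openConn s b))
      (isUpperSet_openConn s x₁).compl (hm _) (hm _)
    rw [← eA₁, ← eZb, ← eDb, ← eHb, mul_comm]
    refine le_trans (le_of_eq ?_) h
    rw [← measureReal_union ?_ (hm _)]
    · congr 1; ext ω; simp only [Set.mem_union, Set.mem_sdiff, Set.mem_inter_iff, Set.mem_compl_iff]; tauto
    · exact Set.disjoint_left.2 fun ω h1 h2 => h2.1.2 h1.1
  have HarFar : (prodBernoulli w0).real (Rc \ W') + (prodBernoulli w0).real (Cf \ W')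
      ≤ (prodBernoulli w0).real (Set.univ \ W') * ((prodBernoulli w0).real Cf + (prodBernoulli w0).real (Rc \ W')) := by
    have h := prodBernoulli_harris_upper_lower w0 ((isUpperSet_openConn c v).union (isUpperSet_openConn s c))
      (isUpperSet_openConn s v).compl (hm _) (hm _)
    rw [← a0, ← hz, ← zc0, ← dc0, ← hc0, mul_comm]
    refine le_trans (le_of_eq ?_) h
    rw [← measureReal_union ?_ (hm _)]
    · congr 1; ext ω; simp only [Set.mem_union, Set.mem_sdiff, Set.mem_inter_iff, Set.mem_compl_iff]; tauto
    · exact Set.disjoint_left.2 fun ω h1 h2 => h2.1.2 h1.1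
  have BrNear' := BrNear
  rw [eA₁, eZb, eDb, eHb] at BrNear'
  have BrFar' := BrFar
  rw [a0, zc0, hz, dc0, hc0] at BrFar'
  -- sign facts
  have hp0 : (0 : ℝ) ≤ w e := (w e).2.1
  have hp1 : (w e : ℝ) ≤ 1 := (w e).2.2
  -- (6) assemble
  rw [hσ, ob (openConn s v)ᶜ, ob (openConn b v \ openConn s v), ob (openConn c v \ openConn s v),
    ob ((openConn b v ∩ openConn c v) \ openConn s v), ob ((openConn b v \ openConn s v) ∩ openConn s c),
    ob ((openConn c v \ openConn s v) ∩ openConn s b), ob (openConn s v ∩ openConn s b), ob (openConn s v ∩ openConn s c),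
    ob (openConn s b), ob (openConn s c),
    a0, a1, db0, db1, dc0, dc1, dbc0, dbc1, xb0, xb1, xc0, xc1, yb0, yb1, yc0, yc1, mb0, mb1, mc0, mc1, hW'c, hSc]
  have key := rs_diffBranch_real (w e) ((prodBernoulli w0).real (Set.univ \ W')) ((prodBernoulli w0).real (Set.univ \ S))
    ((prodBernoulli w0).real (Fb \ S)) ((prodBernoulli w0).real ((Bn \ S) \ Fb)) ((prodBernoulli w0).real Bn)
    ((prodBernoulli w0).real (Bn ∩ S)) ((prodBernoulli w0).real (Rc \ W')) ((prodBernoulli w0).real (Cf \ W'))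
    ((prodBernoulli w0).real Cf) ((prodBernoulli w0).real (Cf ∩ W'))
    hp0 hp1 measureReal_nonneg measureReal_le_one measureReal_nonneg measureReal_le_one measureReal_nonneg measureReal_nonneg
    measureReal_nonneg measureReal_nonneg measureReal_nonneg hk hy BrNear' BrFar' HarNear HarFar
  linarith [key]

end IncStar

end Summit.CriticalPhenomena.PercolationContinuityZ3.Theorems
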